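import Summits.CriticalPhenomena.PercolationContinuityZ3.Theorems.PercNearOneGluingNoHeavyLowerTailMajorityGluingBudgetRow
import Summits.CriticalPhenomena.PercolationContinuityZ3.Theorems.PercNearOneGluingNoHeavyLowerTailMajorityGluingIsoPtsMain
import Summits.CriticalPhenomena.PercolationContinuityZ3.Theorems.PercNearOneGluingNoHeavyLowerTailMajorityGluingWindowBelowCore
import HarnessLib

/-!
# PROPOSITION W₀ as a percolation theorem: `μ(≥ 3 of 4 relays cut) ≤ M + M^{3−√3}` (lane prim-rate, constants-miner 1, gen 31; CANDIDATES §GEN-20 R185, §GEN-31; BENCH l.204 M1-W0)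

Support file for the closed crux `NoHeavyLowerTail` (stmt-CriticalPhenomena-4575), majority-gluing line.  PROPOSITION W₀ of the lane
(`prim-rate-mine-1/PROP-W0.md`; arithmetic core landed as `…MajorityGluingWindowBelowCore`, gen 20) was a PAPER theorem resting on two paper
steps, the vdBHK row `Calone₂` and ISO₃.  Both are now kernel theorems (`Budget.budget_row`, p446253-chain; `IsoPts.iso3_points`, p444247), so the
whole chain is assembled here ON THE PERCOLATION SIDE: for a hub `a`, four relays `T` (`a ∉ T`) and `M ≥ max_{v ∈ T} μ(v ↮ a)`,
  **`μ(at least three relays of T are cut from a) ≤ M + M^{3 − √3}`**   (`threeOfFour_W0`),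
the first bound on the `(4,3)` window cell that tends to `M` as `M → 0` (the van den Berg–Kahn bound of `…MajorityGluingSix` is `(256/243)·M`).
Chain (PROP-W0.md §1), with `v₁` the relay of largest cut probability: (1) `X + S₁ ≤ δ₁ + T₁` (counting); (2) `T₁ ≤ u + S₁` from the budget row
`μ(v₂ cut ∧ B₁ alone) ≤ μ(v₁ cut ∧ B₁ alone)` (`Budget.budget_row` with the down-set «avoids `v₃, v₄`») and two event inclusions;
(3) `u = μ(a, v₁, v₃ pairwise separated)`; (4) `u^{c₃} ≤ r_a r₁ r₃ ≤ M³` (`IsoPts.iso3_points`) and `WindowBelow.iso3_cap`.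
No definitions, no sorries, no named facts. [cite: VandenbergHaggstromKahn2005, Thm. 1.3 (p. 6)]
-/

noncomputable section

namespace Summit.CriticalPhenomena.PercolationContinuityZ3.Theorems

open MeasureTheory Set
open Literature.Probability.LatticeModels (prodBernoulli)
open Literature.Probability.Percolation
open scoped Classical

namespace HubOnly
namespace PropW0

open Refresh

variable {n : ℕ}

/-- Counting the cut relays of `insert v R`: `#cut(insert v R) = [v cut] + #cut(R)` for `v ∉ R`. [folklore] -/
theorem card_filter_insert {R : Finset (Fin n)} {v : Fin n} (hv : v ∉ R) (p : Fin n → Prop) [DecidablePred p] :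
    ((insert v R).filter p).card = (if p v then 1 else 0) + (R.filter p).card := by
  rw [Finset.filter_insert]
  split_ifs with h
  · rw [Finset.card_insert_of_notMem (fun h' => hv (Finset.mem_filter.1 h').1)]; ring
  · ring


/-- Three pairwise facts give all ordered pairs of a `Fin 3`-indexed family (for a symmetric relation). [folklore] -/
theorem pairwise_fin_three {α : Type*} (t : Fin 3 → α) (P : α → α → Prop) (hs : ∀ x y, P x y → P y x)
    (h01 : P (t 0) (t 1)) (h02 : P (t 0) (t 2)) (h12 : P (t 1) (t 2)) : ∀ k l : Fin 3, k ≠ l → P (t k) (t l) := by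
  intro k l hkl
  fin_cases k <;> fin_cases l
  exacts [absurd rfl hkl, h01, h02, hs _ _ h01, absurd rfl hkl, h12, hs _ _ h02, hs _ _ h12, absurd rfl hkl]

/-- A `Fin 3`-indexed family with pairwise distinct values is injective. [folklore] -/
theorem injective_fin_three {α : Type*} (t : Fin 3 → α) (h01 : t 0 ≠ t 1) (h02 : t 0 ≠ t 2) (h12 : t 1 ≠ t 2) :
    Function.Injective t := by
  intro k l h
  fin_cases k <;> fin_cases l
  exacts [rfl, absurd h h01, absurd h h02, absurd h.symm h01, rfl, absurd h h12, absurd h.symm h02, absurd h.symm h12, rfl]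

/-- **PROPOSITION W₀ for four named relays.**  Hub `a`, distinct relays `v₁ v₂ v₃ v₄ ≠ a` with `μ(v₂ ↮ a), μ(v₃ ↮ a) ≤ μ(v₁ ↮ a) ≤ M`:
`μ(≥ 3 of the four cut) ≤ M + M^{3−√3}`. [cite: VandenbergHaggstromKahn2005, Thm. 1.3 (p. 6)] -/
theorem threeOfFour_W0_core (w : Sym2 (Fin n) → unitInterval) (a v₁ v₂ v₃ v₄ : Fin n)
    (h1a : v₁ ≠ a) (h2a : v₂ ≠ a) (h3a : v₃ ≠ a) (h4a : v₄ ≠ a)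
    (h12 : v₁ ≠ v₂) (h13 : v₁ ≠ v₃) (h14 : v₁ ≠ v₄) (h23 : v₂ ≠ v₃) (h24 : v₂ ≠ v₄) (h34 : v₃ ≠ v₄) {M : ℝ}
    (hδ1 : (prodBernoulli w).real {ω : BondConfig (Fin n) | ¬ (openGraph ω).Reachable a v₁} ≤ M)
    (hδ21 : (prodBernoulli w).real {ω : BondConfig (Fin n) | ¬ (openGraph ω).Reachable a v₂} ≤
      (prodBernoulli w).real {ω : BondConfig (Fin n) | ¬ (openGraph ω).Reachable a v₁})
    (hδ31 : (prodBernoulli w).real {ω : BondConfig (Fin n) | ¬ (openGraph ω).Reachable a v₃} ≤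
      (prodBernoulli w).real {ω : BondConfig (Fin n) | ¬ (openGraph ω).Reachable a v₁}) :
    (prodBernoulli w).real {ω : BondConfig (Fin n) |
        3 ≤ (({v₁, v₂, v₃, v₄} : Finset (Fin n)).filter fun v => ¬ (openGraph ω).Reachable a v).card} ≤
      M + M ^ (3 - Real.sqrt 3) := by
  set μ := prodBernoulli w with hμ
  have hms : ∀ S : Set (BondConfig (Fin n)), MeasurableSet S := fun _ => MeasurableSet.of_discrete
  -- events
  set R : Finset (Fin n) := {v₂, v₃, v₄} with hR
  have h1R : v₁ ∉ R := by simp [hR, h12, h13, h14]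
  set X : Set (BondConfig (Fin n)) := {ω | 3 ≤ (((insert v₁ R) : Finset (Fin n)).filter fun v => ¬ (openGraph ω).Reachable a v).card}
    with hX
  set C1 : Set (BondConfig (Fin n)) := {ω | ¬ (openGraph ω).Reachable a v₁} with hC1
  set S1 : Set (BondConfig (Fin n)) := {ω | ¬ (openGraph ω).Reachable a v₁ ∧ (R.filter fun v => ¬ (openGraph ω).Reachable a v).card ≤ 1}
    with hS1
  set T1 : Set (BondConfig (Fin n)) := {ω | (openGraph ω).Reachable a v₁ ∧ ¬ (openGraph ω).Reachable a v₂ ∧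
    ¬ (openGraph ω).Reachable a v₃ ∧ ¬ (openGraph ω).Reachable a v₄} with hT1
  set U : Set (BondConfig (Fin n)) := {ω | ¬ (openGraph ω).Reachable a v₁ ∧ ¬ (openGraph ω).Reachable a v₃ ∧
    ¬ (openGraph ω).Reachable v₁ v₃} with hU
  -- (1) counting: `μ X + μ S₁ ≤ μ C₁ + μ T₁`
  have hcount : ∀ ω : BondConfig (Fin n), ((insert v₁ R : Finset (Fin n)).filter fun v => ¬ (openGraph ω).Reachable a v).card =
      (if ¬ (openGraph ω).Reachable a v₁ then 1 else 0) + (R.filter fun v => ¬ (openGraph ω).Reachable a v).card :=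
    fun ω => card_filter_insert h1R _
  have hRcard : R.card = 3 := by
    rw [hR, Finset.card_insert_of_notMem (by simp [h23, h24]), Finset.card_pair h34]
  have step1 : μ.real X + μ.real S1 ≤ μ.real C1 + μ.real T1 := by
    have hdisj : Disjoint X S1 := by
      rw [Set.disjoint_left]
      rintro ω hx ⟨hc, hle⟩
      simp only [hX, mem_setOf_eq, hcount ω, if_pos hc] at hx
      omega
    rw [← measureReal_union hdisj (hms _)]
    refine (measureReal_mono ?_ (measure_ne_top _ _)).trans (measureReal_union_le _ _)
    rintro ω (hx | ⟨hc, -⟩)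
    · by_cases hc : (openGraph ω).Reachable a v₁
      · right
        simp only [hX, mem_setOf_eq, hcount ω, if_neg (not_not.2 hc), zero_add] at hx
        have hall : (R.filter fun v => ¬ (openGraph ω).Reachable a v).card = R.card :=
          le_antisymm (Finset.card_filter_le _ _) (hRcard ▸ hx)
        rw [Finset.card_filter_eq_iff] at hall
        exact ⟨hc, hall v₂ (by simp [hR]), hall v₃ (by simp [hR]), hall v₄ (by simp [hR])⟩
      · exact Or.inl hc
    · exact Or.inl hc
  -- (2) the budget row `Calone₂` and the two inclusions: `μ T₁ ≤ μ U + μ S₁`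
  have step2 : μ.real T1 ≤ μ.real U + μ.real S1 := by
    set Al : BondConfig (Fin n) → Prop := fun ω => (v₃ ∉ clusOff {a} ω v₁ ∧ v₄ ∉ clusOff {a} ω v₁) ∧ v₂ ∉ clusOff {a} ω v₁ with hAl
    have hrow := Refresh.Budget.budget_row w a v₁ v₂ h1a h2a h12 (fun S => v₃ ∉ S ∧ v₄ ∉ S)
      (fun S S' hSS' hS' => ⟨fun h => hS'.1 (hSS' h), fun h => hS'.2 (hSS' h)⟩) hδ21
    -- split both sides of the row along the state of the other relay
    set Lp : Set (BondConfig (Fin n)) := {ω | ¬ (openGraph ω).Reachable a v₂ ∧ Al ω ∧ (openGraph ω).Reachable a v₁} with hLp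
    set Lq : Set (BondConfig (Fin n)) := {ω | ¬ (openGraph ω).Reachable a v₂ ∧ Al ω ∧ ¬ (openGraph ω).Reachable a v₁} with hLq
    set Rp : Set (BondConfig (Fin n)) := {ω | ¬ (openGraph ω).Reachable a v₁ ∧ Al ω ∧ (openGraph ω).Reachable a v₂} with hRp
    have hL : μ.real {ω : BondConfig (Fin n) | ¬ (openGraph ω).Reachable a v₂ ∧ Al ω} = μ.real Lp + μ.real Lq := by
      rw [← measureReal_union (Set.disjoint_left.2 fun ω h1 h2 => h2.2.2 h1.2.2) (hms _)]
      congr 1; ext ω; simp only [mem_setOf_eq, mem_union, hLp, hLq]; tauto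
    have hRt : μ.real {ω : BondConfig (Fin n) | ¬ (openGraph ω).Reachable a v₁ ∧ Al ω} = μ.real Lq + μ.real Rp := by
      rw [← measureReal_union (Set.disjoint_left.2 fun ω h1 h2 => h1.1 h2.2.2) (hms _)]
      congr 1; ext ω; simp only [mem_setOf_eq, mem_union, hLq, hRp]; tauto
    have hLpRp : μ.real Lp ≤ μ.real Rp := by
      have := hrow; simp only [hAl] at hL hRt; rw [hL, hRt] at this; linarith
    -- `T₁ ⊆ Lp`
    have hT1Lp : T1 ⊆ Lp := by
      rintro ω ⟨h1, h2, h3, h4⟩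
      have hnot : ∀ v, v ≠ a → ¬ (openGraph ω).Reachable a v → v ∉ clusOff {a} ω v₁ := fun v hva hv hmem =>
        hv (not_not.1 (mt (Refresh.Budget.cut_iff_of_mem_block h1a hva hmem).1 (not_not.2 h1)))
      exact ⟨h2, ⟨⟨hnot v₃ h3a h3, hnot v₄ h4a h4⟩, hnot v₂ h2a h2⟩, h1⟩
    -- `Rp ⊆ U ∪ S₁`
    have hRpUS : Rp ⊆ U ∪ S1 := by
      rintro ω ⟨h1, ⟨⟨h3, h4⟩, -⟩, h2⟩
      by_cases h34' : ¬ (openGraph ω).Reachable a v₃ ∧ ¬ (openGraph ω).Reachable a v₄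
      · left
        refine ⟨h1, h34'.1, fun hr => h3 ?_⟩
        rw [clusOff_eq_clus_of_forall_not_reachable (t := ({a} : Finset (Fin n))) (fun x hx => by
          rw [Finset.mem_singleton] at hx; rw [hx]; exact fun h => h1 h.symm)]
        exact mem_clus.2 hr
      · right
        refine ⟨h1, ?_⟩
        -- at most one of `v₂, v₃, v₄` is cut (`v₂` is attached, not both of `v₃, v₄` cut)
        have hv2 : v₂ ∉ R.filter fun v => ¬ (openGraph ω).Reachable a v := fun h => (Finset.mem_filter.1 h).2 h2
        have hsub : (R.filter fun v => ¬ (openGraph ω).Reachable a v) ⊆ ({v₃, v₄} : Finset (Fin n)) := by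
          intro v hv
          obtain ⟨hvR, hvc⟩ := Finset.mem_filter.1 hv
          simp only [hR, Finset.mem_insert, Finset.mem_singleton] at hvR ⊢
          rcases hvR with rfl | rfl | rfl
          · exact absurd hvc (not_not.2 h2)
          · exact Or.inl rfl
          · exact Or.inr rfl
        have hne : (R.filter fun v => ¬ (openGraph ω).Reachable a v) ≠ ({v₃, v₄} : Finset (Fin n)) := by
          intro heq
          apply h34'
          have h3' : v₃ ∈ R.filter fun v => ¬ (openGraph ω).Reachable a v := by rw [heq]; simp
          have h4' : v₄ ∈ R.filter fun v => ¬ (openGraph ω).Reachable a v := by rw [heq]; simp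
          exact ⟨(Finset.mem_filter.1 h3').2, (Finset.mem_filter.1 h4').2⟩
        have hlt := Finset.card_lt_card (Finset.ssubset_iff_subset_ne.2 ⟨hsub, hne⟩)
        rw [Finset.card_pair h34] at hlt
        omega
    calc μ.real T1 ≤ μ.real Lp := measureReal_mono hT1Lp (measure_ne_top _ _)
      _ ≤ μ.real Rp := hLpRp
      _ ≤ μ.real (U ∪ S1) := measureReal_mono hRpUS (measure_ne_top _ _)
      _ ≤ μ.real U + μ.real S1 := measureReal_union_le _ _
  -- (3)+(4) ISO₃ for the points `a, v₁, v₃`: `μ(U)^{c₃} ≤ M³`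
  have step3 : μ.real U ^ ((3 + Real.sqrt 3) / 2) ≤ M ^ (3:ℝ) := by
    have htinj : Function.Injective (![a, v₁, v₃] : Fin 3 → Fin n) :=
      injective_fin_three _ (Ne.symm h1a) (Ne.symm h3a) h13
    have hiso := IsoPts.iso3_points w (![a, v₁, v₃] : Fin 3 → Fin n) htinj
    set PW : Set (BondConfig (Fin n)) := {ω | ∀ k l : Fin 3, k ≠ l →
      ¬ (openGraph ω).Reachable ((![a, v₁, v₃] : Fin 3 → Fin n) k) ((![a, v₁, v₃] : Fin 3 → Fin n) l)} with hPW
    set f : Fin 3 → ℝ := fun k => (prodBernoulli w).real {ω : BondConfig (Fin n) | ∀ l : Fin 3, l ≠ k →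
      ¬ (openGraph ω).Reachable ((![a, v₁, v₃] : Fin 3 → Fin n) k) ((![a, v₁, v₃] : Fin 3 → Fin n) l)} with hf
    have hUle : μ.real U ≤ μ.real PW := by
      refine measureReal_mono (fun ω hω => ?_) (measure_ne_top _ _)
      obtain ⟨h1, h3, h13'⟩ := hω
      exact pairwise_fin_three (![a, v₁, v₃] : Fin 3 → Fin n) (fun x y => ¬ (openGraph ω).Reachable x y)
        (fun x y h hr => h hr.symm) h1 h3 h13'
    have hc0 : 0 ≤ (3 + Real.sqrt 3) / 2 := le_of_lt WindowBelow.c3_pos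
    have hf0 : f 0 ≤ M := by
      have hsub : {ω : BondConfig (Fin n) | ∀ l : Fin 3, l ≠ 0 →
          ¬ (openGraph ω).Reachable ((![a, v₁, v₃] : Fin 3 → Fin n) 0) ((![a, v₁, v₃] : Fin 3 → Fin n) l)} ⊆
          {ω : BondConfig (Fin n) | ¬ (openGraph ω).Reachable a v₃} := by
        intro ω hω
        rw [mem_setOf_eq] at hω ⊢
        exact hω 2 (by decide)
      exact (measureReal_mono hsub (measure_ne_top _ _)).trans (hδ31.trans hδ1)
    have hf1 : f 1 ≤ M := by
      have hsub : {ω : BondConfig (Fin n) | ∀ l : Fin 3, l ≠ 1 →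
          ¬ (openGraph ω).Reachable ((![a, v₁, v₃] : Fin 3 → Fin n) 1) ((![a, v₁, v₃] : Fin 3 → Fin n) l)} ⊆
          {ω : BondConfig (Fin n) | ¬ (openGraph ω).Reachable a v₁} := by
        intro ω hω
        rw [mem_setOf_eq] at hω ⊢
        exact fun h => hω 0 (by decide) h.symm
      exact (measureReal_mono hsub (measure_ne_top _ _)).trans hδ1
    have hf2 : f 2 ≤ M := by
      have hsub : {ω : BondConfig (Fin n) | ∀ l : Fin 3, l ≠ 2 →
          ¬ (openGraph ω).Reachable ((![a, v₁, v₃] : Fin 3 → Fin n) 2) ((![a, v₁, v₃] : Fin 3 → Fin n) l)} ⊆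
          {ω : BondConfig (Fin n) | ¬ (openGraph ω).Reachable a v₃} := by
        intro ω hω
        rw [mem_setOf_eq] at hω ⊢
        exact fun h => hω 0 (by decide) h.symm
      exact (measureReal_mono hsub (measure_ne_top _ _)).trans (hδ31.trans hδ1)
    have hprod : ∏ k : Fin 3, f k ≤ M ^ (3:ℝ) := by
      rw [Fin.prod_univ_three]
      exact WindowBelow.prod_three_le_cube measureReal_nonneg measureReal_nonneg measureReal_nonneg hf0 hf1 hf2
    calc μ.real U ^ ((3 + Real.sqrt 3) / 2) ≤ μ.real PW ^ ((3 + Real.sqrt 3) / 2) :=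
          Real.rpow_le_rpow measureReal_nonneg hUle hc0
      _ ≤ ∏ k : Fin 3, f k := hiso
      _ ≤ M ^ (3:ℝ) := hprod
  -- assembly
  have hM0 : 0 ≤ M := le_trans measureReal_nonneg hδ1
  have hcap : μ.real U ≤ M ^ (3 - Real.sqrt 3) := WindowBelow.iso3_cap measureReal_nonneg hM0 step3
  have hC1 : μ.real C1 ≤ M := hδ1
  linarith

/-- **PROPOSITION W₀ (CANDIDATES §GEN-20 R185; BENCH l.204 M1-W0) AS A KERNEL PERCOLATION THEOREM.**  For every finite weighted graph, hub
`a₀`, four relays `T ∌ a₀` and `δ ≥ max_{v ∈ T} μ(v ↮ a₀)`:  `μ(at least three relays of T cut from a₀) ≤ δ + δ^{3 − √3}` — the `(4,3)` window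
cell «closes from below» (compare `threeOfFour_count`: `(256/243)·δ`).  [cite: VandenbergHaggstromKahn2005, Thm. 1.3 (p. 6)] -/
theorem threeOfFour_W0 (w : Sym2 (Fin n) → unitInterval) (a₀ : Fin n) (T : Finset (Fin n)) (hT : T.card = 4) (haT : a₀ ∉ T) (δ : ℝ)
    (hδ : ∀ v ∈ T, (prodBernoulli w).real (openConn v a₀ : Set (BondConfig (Fin n)))ᶜ ≤ δ) :
    (prodBernoulli w).real {ω : BondConfig (Fin n) | 3 ≤ (T.filter fun v => ω ∉ openConn v a₀).card} ≤ δ + δ ^ (3 - Real.sqrt 3) := by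
  set μ := prodBernoulli w with hμ
  set d : Fin n → ℝ := fun v => μ.real {ω : BondConfig (Fin n) | ¬ (openGraph ω).Reachable a₀ v} with hd
  have hdconn : ∀ v, (openConn v a₀ : Set (BondConfig (Fin n)))ᶜ = {ω : BondConfig (Fin n) | ¬ (openGraph ω).Reachable a₀ v} := by
    intro v; ext ω
    simp only [mem_compl_iff, openConn, mem_setOf_eq]
    exact ⟨fun h hr => h hr.symm, fun h hr => h hr.symm⟩
  -- the relay of largest cut probability
  have hTne : T.Nonempty := by rw [← Finset.card_pos, hT]; norm_num
  obtain ⟨v₁, hv₁T, hmax⟩ := Finset.exists_max_image T d hTne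
  obtain ⟨v₂, v₃, v₄, h23, h24, h34, hTe⟩ := Finset.card_eq_three.1 (by rw [Finset.card_erase_of_mem hv₁T, hT])
  have hmemE : ∀ v, v ∈ T.erase v₁ ↔ v = v₂ ∨ v = v₃ ∨ v = v₄ := fun v => by rw [hTe]; simp
  have h2T : v₂ ∈ T := Finset.mem_of_mem_erase ((hmemE v₂).2 (Or.inl rfl))
  have h3T : v₃ ∈ T := Finset.mem_of_mem_erase ((hmemE v₃).2 (Or.inr (Or.inl rfl)))
  have h4T : v₄ ∈ T := Finset.mem_of_mem_erase ((hmemE v₄).2 (Or.inr (Or.inr rfl)))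
  have h12 : v₁ ≠ v₂ := fun h => Finset.notMem_erase v₁ T (h ▸ (hmemE v₂).2 (Or.inl rfl))
  have h13 : v₁ ≠ v₃ := fun h => Finset.notMem_erase v₁ T (h ▸ (hmemE v₃).2 (Or.inr (Or.inl rfl)))
  have h14 : v₁ ≠ v₄ := fun h => Finset.notMem_erase v₁ T (h ▸ (hmemE v₄).2 (Or.inr (Or.inr rfl)))
  have hne : ∀ v ∈ T, v ≠ a₀ := fun v hv h => haT (h ▸ hv)
  have hTeq : T = ({v₁, v₂, v₃, v₄} : Finset (Fin n)) := by
    rw [← Finset.insert_erase hv₁T, hTe]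
  have hset : {ω : BondConfig (Fin n) | 3 ≤ (T.filter fun v => ω ∉ openConn v a₀).card} =
      {ω : BondConfig (Fin n) | 3 ≤ (({v₁, v₂, v₃, v₄} : Finset (Fin n)).filter fun v => ¬ (openGraph ω).Reachable a₀ v).card} := by
    ext ω
    simp only [mem_setOf_eq, hTeq]
    have : (({v₁, v₂, v₃, v₄} : Finset (Fin n)).filter fun v => ω ∉ openConn v a₀) =
        ({v₁, v₂, v₃, v₄} : Finset (Fin n)).filter fun v => ¬ (openGraph ω).Reachable a₀ v := by
      refine Finset.filter_congr fun v _ => ?_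
      simp only [openConn, mem_setOf_eq]
      exact ⟨fun h hr => h hr.symm, fun h hr => h hr.symm⟩
    rw [this]
  rw [hset]
  have hδ1 : d v₁ ≤ δ := by have := hδ v₁ hv₁T; rwa [hdconn] at this
  have key := threeOfFour_W0_core w a₀ v₁ v₂ v₃ v₄ (hne v₁ hv₁T) (hne v₂ h2T) (hne v₃ h3T) (hne v₄ h4T)
    h12 h13 h14 h23 h24 h34 hδ1 (hmax v₂ h2T) (hmax v₃ h3T)
  exact key

end PropW0
end HubOnly
end Summit.CriticalPhenomena.PercolationContinuityZ3.Theorems
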